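import Literature.MathematicalPhysics.QuantumFieldTheory.Balaban1983to89.B6BlockDecayCalculus
import Literature.MathematicalPhysics.QuantumFieldTheory.Balaban1983to89.B6HjGtOpNormV1
import Literature.MathematicalPhysics.QuantumFieldTheory.Balaban1983to89.B6CovTildeDecayV1

/-!
# `Balaban1983to89.B6BlockDecayHjCovV1` — T. Bałaban, *Propagators and renormalization transformations for lattice gauge theories. II*,
# Commun. Math. Phys. **96** (1984) 223–250 [Balaban1984PropagatorsII], p. 246: the term `H_jC̃^{(j)}_ΛH_j*` of the representation (2.129)
# has an EXPONENTIALLY DECAYING BLOCK KERNEL, UNIFORMLY IN THE VOLUME, IN `j` AND IN `Λ′`, for the concrete two-scale V1 data — block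
# row-sum decay bounds for `H_j`, `H_j*`, `C̃^{(j)}_Λ` of `…B6SectCTwoScaleV1Lattice.tsV1` and their composition (the powers of `n = L^j`
# cancel: `H_j*` costs `n^{d+1}`, `C̃^{(j)}_Λ` gains `n^{−(d+1)}`)

statement-level skeleton of published theorems with citation tags; proofs where landed; nothing here is a claim about the Yang–Mills mass gap

PDF held: `paper:balaban1984-cmp96-propagators-rt-ii` (journal page = PDF page + 222), p. 246 [PDF 24] (text layer grepped by this seat, gen 14).
PRINT (verbatim, p. 246): *"This implies that a covariance C̃^{(j)}_Λ of the Gaussian integral in (2.119) is bounded from above by a positive constant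
dependent on d and L only, and it has an exponential decay with a decay rate having the same property."* … *"From these representations we obtain
all the necessary properties of the operators H_j, G̃_j. They follow from the Proposition 1.2 and from the formulas and the inequalities
(1.99)–(1.101) for Q_jG_jQ_j*."* … *"Proposition 2.5. The operator G_□ defined by (2.90) on the torus T_□ … has the representation (2.129) and
satisfies all the inequalities (1.110)–(1.114) of the Proposition 1.2 with a positive constant δ₂ instead of δ₀. This constant depends on d and
L only."*

CITATION HEADER (lean-in-tree rule) — WHAT IS REPRODUCED.  Phase-2 file of the `lit-balaban` typed skeleton (HOME `run/shared/lean/pub/lit-balaban/`),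
seat **p22 gen 14** (B6 fold owner r03, referee ref-4; lane = Sect. C on `tsV1`), FILE 3 of the PROP. 2.5 TWO-LEVEL DECAY programme (file 1
`…B6Repr2129Operator`: (2.129) as the operator identity `G = K₁ + (I − K₂)*(G̃_j + H_jC̃^{(j)}_ΛH_j*)(I − K₂)`; file 2 `…B6BlockDecayCalculus`:
the block row-sum decay calculus); SKELETON rows **B6.Prop2.5 / B6.Eq2.130 / B6.Txt@246** (cells only; decls of record untouched).  THIS FILE
instances the calculus on the SECOND SUMMAND `H_jC̃^{(j)}_ΛH_j*` of (2.129) for `tsV1`: carriers the fine bonds `T^{(0)}` (positions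
`b₀ ↦ y(b₀₋) ∈ T^{(j)}`, the `j`-fold block map `iterBlockOf j` of `…B5Eq118OneStroke`) and the unit-lattice bonds `T^{(j)}` (positions `b ↦ b₋`),
metric the torus sup-distance `|rep y − rep y′|_T` of file 2 §5.  §1 plumbing: `blockOf_EK_eq_iterBlockOf` (b05's block map `blockOf ∘ EK` IS
`iterBlockOf j` — the two carriers of record agree), fibre counts (`card_fiber_src_iterBlockOf_le`: `≤ n^{d+1}(d+1)` fine bonds over a unit site;
`card_fiber_src_le`: `≤ d+1` unit bonds over a unit site).  §2 **`abs_Hj_entry_le`**: `|H_j(e_b)_{b₀}| ≤ A_H e^{−κ_H|y(b₀₋) − b₋|_T}`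
(`A_H = MG163(d+1)·periodConst`, `κ_H = κ₁₆₃(d+1)/(d+1)`; gen 9/13's `Hj_single_eq_re` = b05's `H_k` kernel, b05's `norm_HkOp_le` BY NAME),
**`blockBound_Hj`** (`(A_H(d+1), κ_H)`), **`blockBound_Hj_adjoint`** (`(A_Hn^{d+1}(d+1), κ_H)` — the column sums of `H_j` over the `n^{d+1}(d+1)` fine
bonds of a block), `blockBound_Ct_of_entry` (`C̃^{(j)}_Λ`: entry decay ⇒ block bound, fibres `d+1`).  §3 **`blockBound_HjCtHj_uniform`**: for every
`d, L` and weight window `0 < a₀ ≤ a₁` there are `δ > 0`, `C ≥ 0` such that for every volume `(m, K)`, every `c ≠ 0`, every `j + 1 ≤ m + K`, every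
`Λ′`, all weights `a₀κ ≤ w ≤ a₁κ` (`κ = c²/(η^{d+1}n²)`, the V1 normalisation of gen 11/12), `H_jC̃^{(j)}_ΛH_j*` has the block bound
`(C·n^{d+1}/κ, δ)`; **`blockBound_HjCtHj_scaling`**: at the paper's scaling `c = η⁻¹ = L^j` (`κ = n^{d+1}`) the block bound is `(C, δ)` — NO
dependence on the volume, `j`, `Λ′` (the composition lemma of file 2 carries no fibre-size factor).  IMPORTS BY NAME, restating nothing
(`covt_kernel_decay_uniform` = the printed C̃ sentence for `tsV1`, gen 12).  THEOREMS ONLY; standard axioms.  HONEST SCOPE: a block-kernel bound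
for ONE summand of (2.129) for the concrete data; the other summands (`K₁`, `K₂`, `G̃_j`) and the assembly into (1.110) for the two-scale `G` are
the next files; constants ours and crude (explicit in §2, existential-uniform in §3); NOT summit progress.  Unit `lit-balaban-p22` (gen 14), 2026-08-22.
-/

noncomputable section

open scoped InnerProductSpace BigOperators
open Finset

namespace Literature.MathematicalPhysics.QuantumFieldTheory.Balaban1983to89.B6BlockDecayHjCovV1

open LatticeFieldCalculus B5SectBStatements B5Eq117TorusCarriers B6SectAOperatorsV1 B6SectCOperators B6SectCOperators.TwoScaleData
  B6SectCTwoScaleV1 B6SectCTwoScaleV1Lattice B5Eq118OneStroke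
open BalabanImbrieJaffe1984to88.BIJ85AxialPropagator411 (BondSpace)
open B4Sect5Torus (IsPseudoDist SumBound)
open B5Prop11Plancherel (Tor fine)
open B5Blocks16 (blockOf_bpt)
open B5G183Kernel (exists_eq_bpt)
open B5Hk163Torus (HkOp norm_HkOp_le)
open B5Hk163Decay (MG163 MG163_nonneg)
open B5Hk163Strip (kappa163 kappa163_pos)
open B4TorusKernel (periodConst)
open B4TorusKernel.MultiPeriod (torusSupNorm torusSupNorm_nonneg)
open B4Sect5Proof (latticeConst latticeConst_nonneg)
open B6LowerBound2153Torus (toT rep toT_rep)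
open B5Kernel166Decay (periodConst_pos)
open B6HprimeOpNormV1 (card_filter_blockOf_EK_le card_filter_eq_le_one)
open B6HjGtOpNormV1 (Hj_single_eq_re card_filter_src_le)
open B6CovTildeDecayV1 (covt_kernel_decay_uniform)
open B6BlockDecayCalculus (blockBound_of_entry blockBound_adjoint_of_entry blockBound_comp torusDist_isPseudoDist torusDist_sumBound)

/-! ## §1  Positions and fibres: the fine bonds over the unit lattice `T^{(j)}` -/

section Positions

variable {P : Params} {j : ℕ}

/-- **the two block maps of record agree**: b05's `blockOf ∘ EK` (used by the `H_j`/`H′_j` kernels) IS the `j`-fold block map `iterBlockOf j` of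
the `Setup` calculus (used by `Q_j` and by [4]'s cubes). [cite: Balaban1984PropagatorsI, (1.18) p.20] -/
theorem blockOf_EK_eq_iterBlockOf (hj' : j ≤ P.m + P.K) (x : Site P 0) :
    B5Blocks16.blockOf (P.L ^ j) (Mk P j) (EK hj' x) = iterBlockOf j x := by
  set y := iterBlockOf j x with hy
  have hx : x ∈ iterBlock j y := (mem_iterBlock j y x).2 rfl
  set r := (blockEquivK hj' y).symm ⟨x, hx⟩ with hr
  have hxr : blockSiteK j y r = x := by
    have h := (blockEquivK hj' y).apply_symm_apply ⟨x, hx⟩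
    rw [← hr] at h
    exact congrArg Subtype.val h
  rw [← hxr, EK_blockSiteK hj', blockOf_bpt]

/-- at most `n^{d}·d` (`n = L^j`, `d = P.d`) fine bonds have their initial point over a given unit site. [cite: Balaban1984PropagatorsI, (1.18) p.20] -/
theorem card_fiber_src_iterBlockOf_le (hj' : j ≤ P.m + P.K) (y : Site P j) :
    (univ.filter fun b₀ : PBond P 0 => iterBlockOf j b₀.src = y).card ≤ (P.L ^ j) ^ P.d * P.d := by
  classical
  have h := card_filter_src_le (fun x : Site P 0 => B5Blocks16.blockOf (P.L ^ j) (Mk P j) (EK hj' x)) (card_filter_blockOf_EK_le hj') y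
  refine le_trans (Finset.card_le_card fun b₀ hb => ?_) h
  rw [Finset.mem_filter] at hb ⊢
  exact ⟨hb.1, by rw [blockOf_EK_eq_iterBlockOf hj']; exact hb.2⟩

/-- at most `d` unit bonds have a given initial point. [cite: Balaban1984PropagatorsI, (1.1) p.18] -/
theorem card_fiber_src_le (y : Site P j) : (univ.filter fun b : PBond P j => b.src = y).card ≤ 1 * P.d := by
  classical
  exact card_filter_src_le (fun x : Site P j => x) (card_filter_eq_le_one (P := P) (j := j)) y

end Positions

/-! ## §2  Block bounds for `H_j`, `H_j*`, `C̃^{(j)}_Λ` of the concrete data -/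

section Factors

/-! r03's torus sup-metric is written with the dimension as `d + 1`; every `P : Params` is of the form `⟨d + 1, L, m, K, _, _⟩`. -/

variable {d L m K : ℕ} [NeZero L] {hd : 1 ≤ d + 1} {hL : Odd L ∧ 1 < L} {c : ℝ} (hc : c ≠ 0) {j : ℕ}
  (hj : j + 1 ≤ (⟨d + 1, L, m, K, hd, hL⟩ : Params).m + (⟨d + 1, L, m, K, hd, hL⟩ : Params).K)
  (Λ' : Finset (Site (⟨d + 1, L, m, K, hd, hL⟩ : Params) (j + 1))) {w : CIdx j Λ' → ℝ} (hw : ∀ i, 0 < w i)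
  [DecidableEq (PBond (⟨d + 1, L, m, K, hd, hL⟩ : Params) j)] [DecidableEq (PBond (⟨d + 1, L, m, K, hd, hL⟩ : Params) 0)]

omit [DecidableEq (PBond (⟨d + 1, L, m, K, hd, hL⟩ : Params) 0)] in
include hj hw in
/-- **THE KERNEL OF THE CONCRETE `H_j` DECAYS**: `|H_j(e_b)_{b₀}| ≤ A_H·e^{−κ_H|y(b₀₋) − b₋|_T}` for every unit bond `b` of `T^{(j)}` and fine bond
`b₀` of `T^{(0)}` (`y(·)` = `iterBlockOf j`; gen 9's identification `Hj_single_eq_re` with b05's `H_k` kernel and b05's `norm_HkOp_le` BY NAME),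
uniformly in the volume, `j`, `Λ′`, the weights and `c`. [cite: Balaban1984PropagatorsII, (2.130) p.246] -/
theorem abs_Hj_entry_le (b₀ : PBond (⟨d + 1, L, m, K, hd, hL⟩ : Params) 0) (b : PBond (⟨d + 1, L, m, K, hd, hL⟩ : Params) j) :
    |(tsV1 hc Λ' w).Hj (EuclideanSpace.single b (1 : ℝ)) b₀| ≤
      (MG163 (d + 1) * periodConst (kappa163 (d + 1)) d) * Real.exp (-((kappa163 (d + 1) / ((d : ℝ) + 1)) * torusSupNorm (Mk (⟨d + 1, L, m, K, hd, hL⟩ : Params) j) (rep (Mk (⟨d + 1, L, m, K, hd, hL⟩ : Params) j) (iterBlockOf j b₀.src) - rep (Mk (⟨d + 1, L, m, K, hd, hL⟩ : Params) j) b.src))) := by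
  classical
  have hj' : j ≤ m + K := Nat.le_of_succ_le hj
  rw [Hj_single_eq_re hc hj Λ' hw]
  obtain ⟨y', r, h⟩ := exists_eq_bpt (L ^ j) (Mk (⟨d + 1, L, m, K, hd, hL⟩ : Params) j) (EK hj' b₀.src)
  have hb : iterBlockOf j b₀.src = y' := by
    rw [← blockOf_EK_eq_iterBlockOf hj', h, blockOf_bpt]
  rw [hb, h]
  have h2 := norm_HkOp_le (L ^ j) (Mk (⟨d + 1, L, m, K, hd, hL⟩ : Params) j) b₀.dir b.dir r (rep (Mk (⟨d + 1, L, m, K, hd, hL⟩ : Params) j) y') (rep (Mk (⟨d + 1, L, m, K, hd, hL⟩ : Params) j) b.src)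
  rw [toT_rep, toT_rep] at h2
  exact (Complex.abs_re_le_norm _).trans h2

omit [DecidableEq (PBond (⟨d + 1, L, m, K, hd, hL⟩ : Params) 0)] in
include hj hw in
/-- **block bound for `H_j`** (unit bonds → fine bonds): `Σ_{b : b₋ = y}|H_j(e_b)_{b₀}| ≤ A_H(d+1)·e^{−κ_H|y(b₀₋) − y|_T}`.
[cite: Balaban1984PropagatorsII, (2.130) p.246] -/
theorem blockBound_Hj (b₀ : PBond (⟨d + 1, L, m, K, hd, hL⟩ : Params) 0) (y : Site (⟨d + 1, L, m, K, hd, hL⟩ : Params) j) :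
    ∑ b ∈ univ.filter (fun b : PBond (⟨d + 1, L, m, K, hd, hL⟩ : Params) j => b.src = y), |(tsV1 hc Λ' w).Hj (EuclideanSpace.single b (1 : ℝ)) b₀| ≤
      (MG163 (d + 1) * periodConst (kappa163 (d + 1)) d) * ((1 * (d + 1) : ℕ) : ℝ) * Real.exp (-((kappa163 (d + 1) / ((d : ℝ) + 1)) * torusSupNorm (Mk (⟨d + 1, L, m, K, hd, hL⟩ : Params) j) (rep (Mk (⟨d + 1, L, m, K, hd, hL⟩ : Params) j) (iterBlockOf j b₀.src) - rep (Mk (⟨d + 1, L, m, K, hd, hL⟩ : Params) j) y))) := by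
  classical
  exact blockBound_of_entry (ρ := (fun t t' : Site (⟨d + 1, L, m, K, hd, hL⟩ : Params) j => torusSupNorm (Mk (⟨d + 1, L, m, K, hd, hL⟩ : Params) j) (rep (Mk (⟨d + 1, L, m, K, hd, hL⟩ : Params) j) t - rep (Mk (⟨d + 1, L, m, K, hd, hL⟩ : Params) j) t'))) (tsV1 hc Λ' w).Hj (fun b₀ : PBond (⟨d + 1, L, m, K, hd, hL⟩ : Params) 0 => iterBlockOf j b₀.src) (fun b : PBond (⟨d + 1, L, m, K, hd, hL⟩ : Params) j => b.src)
    (mul_nonneg (MG163_nonneg _) (periodConst_pos (kappa163_pos _) _).le) (card_fiber_src_le (P := (⟨d + 1, L, m, K, hd, hL⟩ : Params)))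
    (fun b₀ b => abs_Hj_entry_le hc hj Λ' hw b₀ b) b₀ y

include hj hw in
/-- **block bound for `H_j*`** (fine bonds → unit bonds; the COLUMN sums of `H_j` over the `n^{d+1}(d+1)` fine bonds over a unit site):
`Σ_{b₀ : y(b₀₋) = y}|H_j*(e_{b₀})_b| ≤ A_Hn^{d+1}(d+1)·e^{−κ_H|b₋ − y|_T}`. [cite: Balaban1984PropagatorsII, (2.130) p.246] -/
theorem blockBound_Hj_adjoint (b : PBond (⟨d + 1, L, m, K, hd, hL⟩ : Params) j) (y : Site (⟨d + 1, L, m, K, hd, hL⟩ : Params) j) :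
    ∑ b₀ ∈ univ.filter (fun b₀ : PBond (⟨d + 1, L, m, K, hd, hL⟩ : Params) 0 => iterBlockOf j b₀.src = y),
        |LinearMap.adjoint (tsV1 hc Λ' w).Hj (EuclideanSpace.single b₀ (1 : ℝ)) b| ≤
      (MG163 (d + 1) * periodConst (kappa163 (d + 1)) d) * (((L ^ j) ^ (d + 1) * (d + 1) : ℕ) : ℝ) * Real.exp (-((kappa163 (d + 1) / ((d : ℝ) + 1)) * torusSupNorm (Mk (⟨d + 1, L, m, K, hd, hL⟩ : Params) j) (rep (Mk (⟨d + 1, L, m, K, hd, hL⟩ : Params) j) b.src - rep (Mk (⟨d + 1, L, m, K, hd, hL⟩ : Params) j) y))) := by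
  classical
  have hj' : j ≤ m + K := Nat.le_of_succ_le hj
  exact blockBound_adjoint_of_entry (ρ := (fun t t' : Site (⟨d + 1, L, m, K, hd, hL⟩ : Params) j => torusSupNorm (Mk (⟨d + 1, L, m, K, hd, hL⟩ : Params) j) (rep (Mk (⟨d + 1, L, m, K, hd, hL⟩ : Params) j) t - rep (Mk (⟨d + 1, L, m, K, hd, hL⟩ : Params) j) t'))) (torusDist_isPseudoDist (Mk (⟨d + 1, L, m, K, hd, hL⟩ : Params) j)) (tsV1 hc Λ' w).Hj (fun b₀ : PBond (⟨d + 1, L, m, K, hd, hL⟩ : Params) 0 => iterBlockOf j b₀.src)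
    (fun b : PBond (⟨d + 1, L, m, K, hd, hL⟩ : Params) j => b.src) (mul_nonneg (MG163_nonneg _) (periodConst_pos (kappa163_pos _) _).le)
    (card_fiber_src_iterBlockOf_le (P := (⟨d + 1, L, m, K, hd, hL⟩ : Params)) hj') (fun b₀ b => abs_Hj_entry_le hc hj Λ' hw b₀ b) b y

omit [NeZero L] [DecidableEq (PBond (⟨d + 1, L, m, K, hd, hL⟩ : Params) 0)] in
/-- **block bound for `C̃^{(j)}_Λ` from its entry decay** (fibres: the `d+1` unit bonds over a unit site). [cite: Balaban1984PropagatorsII, p.246 (text after (2.128))] -/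
theorem blockBound_Ct_of_entry {E δ : ℝ} (hE : 0 ≤ E)
    (hCt : ∀ b b' : PBond (⟨d + 1, L, m, K, hd, hL⟩ : Params) j, |⟪EuclideanSpace.single b (1 : ℝ), (tsV1 hc Λ' w).Ct (EuclideanSpace.single b' (1 : ℝ))⟫_ℝ| ≤
      E * Real.exp (-(δ * torusSupNorm (Mk (⟨d + 1, L, m, K, hd, hL⟩ : Params) j) (rep (Mk (⟨d + 1, L, m, K, hd, hL⟩ : Params) j) b.src - rep (Mk (⟨d + 1, L, m, K, hd, hL⟩ : Params) j) b'.src))))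
    (b : PBond (⟨d + 1, L, m, K, hd, hL⟩ : Params) j) (y : Site (⟨d + 1, L, m, K, hd, hL⟩ : Params) j) :
    ∑ b' ∈ univ.filter (fun b' : PBond (⟨d + 1, L, m, K, hd, hL⟩ : Params) j => b'.src = y), |(tsV1 hc Λ' w).Ct (EuclideanSpace.single b' (1 : ℝ)) b| ≤
      E * ((1 * (d + 1) : ℕ) : ℝ) * Real.exp (-(δ * torusSupNorm (Mk (⟨d + 1, L, m, K, hd, hL⟩ : Params) j) (rep (Mk (⟨d + 1, L, m, K, hd, hL⟩ : Params) j) b.src - rep (Mk (⟨d + 1, L, m, K, hd, hL⟩ : Params) j) y))) := by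
  classical
  refine blockBound_of_entry (ρ := (fun t t' : Site (⟨d + 1, L, m, K, hd, hL⟩ : Params) j => torusSupNorm (Mk (⟨d + 1, L, m, K, hd, hL⟩ : Params) j) (rep (Mk (⟨d + 1, L, m, K, hd, hL⟩ : Params) j) t - rep (Mk (⟨d + 1, L, m, K, hd, hL⟩ : Params) j) t'))) (tsV1 hc Λ' w).Ct (fun b : PBond (⟨d + 1, L, m, K, hd, hL⟩ : Params) j => b.src) (fun b : PBond (⟨d + 1, L, m, K, hd, hL⟩ : Params) j => b.src) hE
    (card_fiber_src_le (P := (⟨d + 1, L, m, K, hd, hL⟩ : Params))) (fun b b' => ?_) b y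
  have h := hCt b b'
  rwa [EuclideanSpace.inner_single_left, map_one, one_mul] at h

end Factors

/-! ## §3  `H_jC̃^{(j)}_ΛH_j*` has an exponentially decaying block kernel, uniformly in the volume, `j`, `Λ′` -/

section Uniform

variable {d L m K : ℕ} {hd : 1 ≤ d + 1} {hL : Odd L ∧ 1 < L} {j : ℕ}

open Classical in
/-- **THE SECOND SUMMAND OF (2.129) DECAYS, UNIFORMLY**: for every dimension `d + 1`, block size `L` and weight window `0 < a₀ ≤ a₁` there are
`δ > 0` and `C ≥ 0` such that for every volume `(m, K)`, every `c ≠ 0`, every `j + 1 ≤ m + K`, every `Λ′ ⊂ T^{(j+1)}`, all weights `a₀κ ≤ w ≤ a₁κ`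
(`κ = c²/(η^{d+1}n²)`) and all fine bonds `b₀`, unit sites `y`:
`Σ_{b₀′ : y(b₀′₋) = y} |(H_jC̃^{(j)}_ΛH_j*)(e_{b₀′})_{b₀}| ≤ C·(n^{d+1}/κ)·e^{−δ|y(b₀₋) − y|_T}` — `H_j` (rate `κ_H`, constant `A_H(d+1)`), `C̃^{(j)}_Λ`
(gen 12's `covt_kernel_decay_uniform`: entries `≤ 2Γ/(min(a₀,1)κ)·e^{−δ_C|·|_T}`), `H_j*` (constant `A_Hn^{d+1}(d+1)`), composed by file 2's
`blockBound_comp` (two lattice-sum factors, no fibre factor). [cite: Balaban1984PropagatorsII, Prop. 2.5 p.246] -/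
theorem blockBound_HjCtHj_uniform (d L : ℕ) (hd : 1 ≤ d + 1) (hL : Odd L ∧ 1 < L) {a₀ a₁ : ℝ} (ha₀ : 0 < a₀) (ha₁ : a₀ ≤ a₁) :
    ∃ δ : ℝ, 0 < δ ∧ ∃ C : ℝ, 0 ≤ C ∧ ∀ (m K : ℕ) (c : ℝ) (hc : c ≠ 0) (j : ℕ)
      (_hj : j + 1 ≤ (⟨d + 1, L, m, K, hd, hL⟩ : Params).m + (⟨d + 1, L, m, K, hd, hL⟩ : Params).K)
      (Λ' : Finset (Site (⟨d + 1, L, m, K, hd, hL⟩ : Params) (j + 1))) (w : CIdx j Λ' → ℝ)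
      (_hw0 : ∀ i, a₀ * (c ^ 2 / (eta L j ^ (d + 1) * ((L : ℝ) ^ j) ^ 2)) ≤ w i)
      (_hw1 : ∀ i, w i ≤ a₁ * (c ^ 2 / (eta L j ^ (d + 1) * ((L : ℝ) ^ j) ^ 2)))
      (b₀ : PBond (⟨d + 1, L, m, K, hd, hL⟩ : Params) 0) (y : Site (⟨d + 1, L, m, K, hd, hL⟩ : Params) j),
      ∑ b₀' ∈ univ.filter (fun b₀' : PBond (⟨d + 1, L, m, K, hd, hL⟩ : Params) 0 => iterBlockOf j b₀'.src = y),
          |((tsV1 hc Λ' w).Hj ∘ₗ (tsV1 hc Λ' w).Ct ∘ₗ LinearMap.adjoint (tsV1 hc Λ' w).Hj) (EuclideanSpace.single b₀' (1 : ℝ)) b₀| ≤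
        C * ((((L : ℝ) ^ j) ^ (d + 1)) / (c ^ 2 / (eta L j ^ (d + 1) * ((L : ℝ) ^ j) ^ 2))) *
          Real.exp (-(δ * torusSupNorm (Mk (⟨d + 1, L, m, K, hd, hL⟩ : Params) j)
            (rep (Mk (⟨d + 1, L, m, K, hd, hL⟩ : Params) j) (iterBlockOf j b₀.src) - rep (Mk (⟨d + 1, L, m, K, hd, hL⟩ : Params) j) y))) := by
  obtain ⟨δC, hδC, hCt⟩ := covt_kernel_decay_uniform d L hd hL ha₀ ha₁
  -- the rates: `δ′ = min(δ_C/2, κ_H)` after `C̃ ∘ H_j*`, `δ = min(δ_C/2, κ_H/2)` after `H_j ∘ (C̃H_j*)`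
  set κH' : ℝ := kappa163 (d + 1) / ((d : ℝ) + 1) with hκH'
  have hκH0 : 0 < κH' := div_pos (kappa163_pos _) (by positivity)
  set δ₁ : ℝ := min (δC / 2) κH' with hδ₁
  set δ₂ : ℝ := min (δC / 2) (κH' / 2) with hδ₂
  have hδ₁0 : 0 < δ₁ := lt_min (half_pos hδC) hκH0
  have hδ₂0 : 0 < δ₂ := lt_min (half_pos hδC) (half_pos hκH0)
  have hδ₁C : δ₁ < δC := lt_of_le_of_lt (min_le_left _ _) (half_lt_self hδC)
  have hδ₁H : δ₁ ≤ κH' := min_le_right _ _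
  have hδ₂₁ : δ₂ ≤ δ₁ := le_min (min_le_left _ _) ((min_le_right _ _).trans (half_le_self hκH0.le))
  have hδ₂H : δ₂ < κH' := lt_of_le_of_lt (min_le_right _ _) (half_lt_self hκH0)
  -- the constants
  set A : ℝ := MG163 (d + 1) * periodConst (kappa163 (d + 1)) d with hA
  have hA0 : 0 ≤ A := mul_nonneg (MG163_nonneg _) (periodConst_pos (kappa163_pos _) _).le
  set Γi : ℝ := (481 * ((d + 1 : ℕ) : ℝ) ^ 6 * (L : ℝ) ^ (2 * (d + 1) + 4))⁻¹ with hΓi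
  have hL0 : 0 < L := by have := hL.2; omega
  haveI : NeZero L := ⟨by omega⟩
  have hLp : (0 : ℝ) < L := by exact_mod_cast hL0
  have hΓi0 : 0 < Γi := by positivity
  set K₁ : ℝ := latticeConst (d + 1) (δC - δ₁) with hK₁
  set K₂ : ℝ := latticeConst (d + 1) (κH' - δ₂) with hK₂
  have hK₁0 : 0 ≤ K₁ := latticeConst_nonneg _ (by linarith)
  have hK₂0 : 0 ≤ K₂ := latticeConst_nonneg _ (by linarith)
  set C : ℝ := A * ((1 * (d + 1) : ℕ) : ℝ) * ((2 / (min a₀ 1 * Γi) * ((1 * (d + 1) : ℕ) : ℝ)) * (A * ((d + 1 : ℕ) : ℝ)) * K₁) * K₂ with hC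
  have hm0 : 0 < min a₀ 1 := lt_min ha₀ one_pos
  have hC0 : 0 ≤ C := by positivity
  refine ⟨δ₂, hδ₂0, C, hC0, ?_⟩
  intro m K c hc j hj Λ' w hw0 hw1 b₀ y
  -- abbreviations
  set κ : ℝ := c ^ 2 / (eta L j ^ (d + 1) * ((L : ℝ) ^ j) ^ 2) with hκ
  have hκ0 : 0 < κ := B6Ineq2118TwoScaleV1.kappa_pos (P := (⟨d + 1, L, m, K, hd, hL⟩ : Params)) hc (j := j)
  have hw : ∀ i, 0 < w i := fun i => lt_of_lt_of_le (mul_pos ha₀ hκ0) (hw0 i)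
  set n : ℝ := ((L : ℝ) ^ j) ^ (d + 1) with hn
  have hn0 : 0 < n := by positivity
  have hρ := torusDist_isPseudoDist (Mk (⟨d + 1, L, m, K, hd, hL⟩ : Params) j)
  have hK := torusDist_sumBound (Mk (⟨d + 1, L, m, K, hd, hL⟩ : Params) j)
  -- (a) the three factor bounds
  have hH := blockBound_Hj hc hj Λ' hw
  have hHs := blockBound_Hj_adjoint hc hj Λ' hw
  have hE0 : 0 ≤ 2 / (min (a₀ * κ) κ * Γi) := by
    have : 0 < min (a₀ * κ) κ := lt_min (mul_pos ha₀ hκ0) hκ0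
    positivity
  have hCtB := blockBound_Ct_of_entry hc Λ' (w := w) hE0 (fun b b' => hCt m K c hc j hj Λ' w hw0 hw1 b b')
  -- (b) `C̃ ∘ H_j*` at rate `δ₁`
  have h1 := blockBound_comp hρ hK (tsV1 hc Λ' w).Ct (LinearMap.adjoint (tsV1 hc Λ' w).Hj)
    (fun b : PBond (⟨d + 1, L, m, K, hd, hL⟩ : Params) j => b.src) (fun b : PBond (⟨d + 1, L, m, K, hd, hL⟩ : Params) j => b.src) (fun b₀ : PBond (⟨d + 1, L, m, K, hd, hL⟩ : Params) 0 => iterBlockOf j b₀.src)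
    (Cf := 2 / (min (a₀ * κ) κ * Γi) * ((1 * (d + 1) : ℕ) : ℝ)) (Cg := A * (((L ^ j) ^ (d + 1) * (d + 1) : ℕ) : ℝ))
    (by positivity) (by positivity) hδ₁0.le hδ₁H hδ₁C hCtB hHs
  -- (c) `H_j ∘ (C̃H_j*)` at rate `δ₂`
  have h2 := blockBound_comp hρ hK (tsV1 hc Λ' w).Hj ((tsV1 hc Λ' w).Ct ∘ₗ LinearMap.adjoint (tsV1 hc Λ' w).Hj)
    (fun b₀ : PBond (⟨d + 1, L, m, K, hd, hL⟩ : Params) 0 => iterBlockOf j b₀.src) (fun b : PBond (⟨d + 1, L, m, K, hd, hL⟩ : Params) j => b.src) (fun b₀ : PBond (⟨d + 1, L, m, K, hd, hL⟩ : Params) 0 => iterBlockOf j b₀.src)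
    (Cf := A * ((1 * (d + 1) : ℕ) : ℝ))
    (Cg := 2 / (min (a₀ * κ) κ * Γi) * ((1 * (d + 1) : ℕ) : ℝ) * (A * (((L ^ j) ^ (d + 1) * (d + 1) : ℕ) : ℝ)) * K₁)
    (by positivity) (by positivity) hδ₂0.le hδ₂₁ hδ₂H hH h1 b₀ y
  refine h2.trans (le_of_eq ?_)
  -- (d) the constants agree: `min(a₀κ, κ) = min(a₀,1)·κ`, `n^{d+1}(d+1)/κ`
  have hmin : min (a₀ * κ) κ = min a₀ 1 * κ := by rw [min_mul_of_nonneg _ _ hκ0.le, one_mul]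
  have hcast : (((L ^ j) ^ (d + 1) * (d + 1) : ℕ) : ℝ) = n * ((d + 1 : ℕ) : ℝ) := by rw [hn]; push_cast; ring
  rw [hmin, hcast, hC]
  field_simp
  ring

open Classical in
/-- **… AT THE PAPER'S SCALING `c = η⁻¹ = L^j`** (`κ = n^{d+1}`, weights `a₀n^{d+1} ≤ w ≤ a₁n^{d+1}`, i.e. [4]'s `a₀ ≤ a ≤ a₁`): the block kernel of
`H_jC̃^{(j)}_ΛH_j*` is bounded by `C·e^{−δ|y(b₀₋) − y|_T}` with `δ > 0`, `C ≥ 0` depending on `d, L, a₀, a₁` ONLY — *"This constant depends on d and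
L only"*. [cite: Balaban1984PropagatorsII, Prop. 2.5 p.246] -/
theorem blockBound_HjCtHj_scaling (d L : ℕ) (hd : 1 ≤ d + 1) (hL : Odd L ∧ 1 < L) {a₀ a₁ : ℝ} (ha₀ : 0 < a₀) (ha₁ : a₀ ≤ a₁) :
    ∃ δ : ℝ, 0 < δ ∧ ∃ C : ℝ, 0 ≤ C ∧ ∀ (m K : ℕ) (j : ℕ) (hc : ((L : ℝ) ^ j) ≠ 0)
      (_hj : j + 1 ≤ (⟨d + 1, L, m, K, hd, hL⟩ : Params).m + (⟨d + 1, L, m, K, hd, hL⟩ : Params).K)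
      (Λ' : Finset (Site (⟨d + 1, L, m, K, hd, hL⟩ : Params) (j + 1))) (w : CIdx j Λ' → ℝ)
      (_hw0 : ∀ i, a₀ * ((L : ℝ) ^ j) ^ (d + 1) ≤ w i) (_hw1 : ∀ i, w i ≤ a₁ * ((L : ℝ) ^ j) ^ (d + 1))
      (b₀ : PBond (⟨d + 1, L, m, K, hd, hL⟩ : Params) 0) (y : Site (⟨d + 1, L, m, K, hd, hL⟩ : Params) j),
      ∑ b₀' ∈ univ.filter (fun b₀' : PBond (⟨d + 1, L, m, K, hd, hL⟩ : Params) 0 => iterBlockOf j b₀'.src = y),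
          |((tsV1 hc Λ' w).Hj ∘ₗ (tsV1 hc Λ' w).Ct ∘ₗ LinearMap.adjoint (tsV1 hc Λ' w).Hj) (EuclideanSpace.single b₀' (1 : ℝ)) b₀| ≤
        C * Real.exp (-(δ * torusSupNorm (Mk (⟨d + 1, L, m, K, hd, hL⟩ : Params) j)
            (rep (Mk (⟨d + 1, L, m, K, hd, hL⟩ : Params) j) (iterBlockOf j b₀.src) - rep (Mk (⟨d + 1, L, m, K, hd, hL⟩ : Params) j) y))) := by
  obtain ⟨δ, hδ, C, hC, h⟩ := blockBound_HjCtHj_uniform d L hd hL ha₀ ha₁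
  refine ⟨δ, hδ, C, hC, fun m K j hc hj Λ' w hw0 hw1 b₀ y => ?_⟩
  have hL0 : 0 < L := by have := hL.2; omega
  have hLp : (0 : ℝ) < L := by exact_mod_cast hL0
  -- at `c = L^j`: `κ = c²/(η^{d+1}n²) = (L^j)^{d+1}`
  have hκ : ((L : ℝ) ^ j) ^ 2 / (eta L j ^ (d + 1) * ((L : ℝ) ^ j) ^ 2) = ((L : ℝ) ^ j) ^ (d + 1) := by
    rw [eta, inv_pow, div_eq_iff (by positivity)]
    field_simp
  have h' := h m K ((L : ℝ) ^ j) hc j hj Λ' w (fun i => by rw [hκ]; exact hw0 i) (fun i => by rw [hκ]; exact hw1 i) b₀ y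
  rw [hκ, div_self (by positivity), mul_one] at h'
  exact h'

end Uniform

end Literature.MathematicalPhysics.QuantumFieldTheory.Balaban1983to89.B6BlockDecayHjCovV1

end
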